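import Summits.AtomisticToContinuum.Crystallization.Theses.PricedLinkCensus
import Literature.MathematicalPhysics.StatisticalMechanics.LennardJonesClusters

/-!
# `TruncatedCensusGap` / Negative: injectivity is load-bearing

Negative knowledge for crux `stmt-AtomisticToContinuum-14230`
(`PricedLinkCensus.TruncatedCensusGap`), crux-disprover seat g2 (2026-08-15).

`TruncatedCensusGap` quantifies over INJECTIVE finite configurations `y`.  Dropping
`Function.Injective y`, the inequality `N · e_χ* + κ · #charged ≤ E_χ(y)` is false for EVERY
`κ ≥ 0` and WHATEVER the value of the periodic infimum `e_χ*`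
(`truncatedCensusGap_false_without_injective'`): `M` coincident points at `0` and `M` at the
unit vector `e₀` have truncated energy `-M²/12` (the diagonal value `V_χ 0 = 0` comes from Lean's
`0⁻¹ = 0`), an energy density `-M/24 → -∞`, eventually below `2M · e_χ*`.  This is the one
refuting mechanism against the crux that needs no lower bound on `e_χ*`; every other one does
(see the crux work file `Cruxes/TruncatedCensusGap/Disproof.lean`).  Nothing here closes an item.
-/

noncomputable section

namespace Summit.AtomisticToContinuum.Crystallization.Theorems

open Literature.MathematicalPhysics.StatisticalMechanics

/-- A totally coincident configuration has zero truncated energy (`V_χ 0 = 0`). [folklore] -/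
theorem interactionEnergy_truncLJ_const {N : ℕ} (p : EuclideanSpace ℝ (Fin 3)) :
    interactionEnergy (fun r => min 1 (max 0 (4 - 2 * r)) * lennardJones r) (fun _ : Fin N => p)
      = 0 := by
  simp [interactionEnergy, lennardJones_zero]

/-- `M` points at `0` followed by `M` points at `e₀`: only the `M²` cross pairs, at distance `1`,
contribute, and the truncated energy is `-M²/12`. [folklore] -/
theorem interactionEnergy_truncLJ_twoPoles (M : ℕ) :
    interactionEnergy (fun r => min 1 (max 0 (4 - 2 * r)) * lennardJones r)
      (Fin.append (fun _ : Fin M => (0 : EuclideanSpace ℝ (Fin 3)))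
        (fun _ : Fin M => EuclideanSpace.single 0 1)) = -((M : ℝ) * M / 12) := by
  have h0 : (fun r : ℝ => min 1 (max 0 (4 - 2 * r)) * lennardJones r) 0 = 0 := by
    simp [lennardJones_zero]
  have hd : dist (0 : EuclideanSpace ℝ (Fin 3)) (EuclideanSpace.single 0 1) = 1 := by
    rw [dist_comm, dist_zero_right]
    simp
  have hmin : min (1 : ℝ) (max 0 (4 - 2 * 1)) = 1 := by norm_num
  rw [interactionEnergy_append _ h0, interactionEnergy_truncLJ_const, interactionEnergy_truncLJ_const]
  simp only [hd, hmin, lennardJones_one, Finset.sum_const, Finset.card_univ, Fintype.card_fin,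
    nsmul_eq_mul]
  ring

/-- **Injectivity is load-bearing in `TruncatedCensusGap`, for every `κ ≥ 0` and every value of
the periodic infimum**: with coincident points allowed, `M + M` points at the two ends of a unit
segment have energy density `-M/24 → -∞`. [folklore] -/
theorem truncatedCensusGap_false_without_injective' (κ : ℝ) (hκ : 0 ≤ κ) :
    ¬ ∀ (N : ℕ) (y : Fin N → EuclideanSpace ℝ (Fin 3)),
      (N : ℝ) * (⨅ Q : PeriodicConfiguration 3,
          Q.energyPerParticle (fun r => min 1 (max 0 (4 - 2 * r)) * lennardJones r)) +
        κ * (Nat.card {i : Fin N // ¬ Literature.Geometry.DiscreteGeometry.IsChargeFree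
          (1 / 100 : ℝ) y i} : ℝ) ≤
      interactionEnergy (fun r => min 1 (max 0 (4 - 2 * r)) * lennardJones r) y := by
  intro h
  set e : ℝ := ⨅ Q : PeriodicConfiguration 3,
    Q.energyPerParticle (fun r => min 1 (max 0 (4 - 2 * r)) * lennardJones r)
  obtain ⟨M, hM⟩ := exists_nat_gt (-24 * e)
  have key := h (M + 1 + (M + 1)) (Fin.append (fun _ : Fin (M + 1) => (0 : EuclideanSpace ℝ (Fin 3)))
    (fun _ : Fin (M + 1) => EuclideanSpace.single 0 1))
  rw [interactionEnergy_truncLJ_twoPoles] at key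
  have hc : (0 : ℝ) ≤ κ * (Nat.card {i : Fin (M + 1 + (M + 1)) //
      ¬ Literature.Geometry.DiscreteGeometry.IsChargeFree (1 / 100 : ℝ)
        (Fin.append (fun _ : Fin (M + 1) => (0 : EuclideanSpace ℝ (Fin 3)))
          (fun _ : Fin (M + 1) => EuclideanSpace.single 0 1)) i} : ℝ) :=
    mul_nonneg hκ (Nat.cast_nonneg _)
  have hM0 : (0 : ℝ) ≤ M := Nat.cast_nonneg M
  push_cast at key
  nlinarith

/-- **`TruncatedCensusGap` with `Function.Injective` dropped is false.** [folklore] -/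
theorem truncatedCensusGap_false_without_injective :
    ¬ ∃ κ : ℝ, 0 < κ ∧ ∀ (N : ℕ) (y : Fin N → EuclideanSpace ℝ (Fin 3)),
      (N : ℝ) * (⨅ Q : PeriodicConfiguration 3,
          Q.energyPerParticle (fun r => min 1 (max 0 (4 - 2 * r)) * lennardJones r)) +
        κ * (Nat.card {i : Fin N // ¬ Literature.Geometry.DiscreteGeometry.IsChargeFree
          (1 / 100 : ℝ) y i} : ℝ) ≤
      interactionEnergy (fun r => min 1 (max 0 (4 - 2 * r)) * lennardJones r) y :=
  fun ⟨κ, hκ, h⟩ => truncatedCensusGap_false_without_injective' κ hκ.le h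

end Summit.AtomisticToContinuum.Crystallization.Theorems

end
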